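import Summits.QuantumFields.BalabanUV.T4Continuum.Support.NE7GaugeActChartTransfer
import HarnessLib

/-!
# NE7GaugeActChartTransferL — THE LINEAR FORM OF THE CHART TRANSFER (ROAD-G114 §11 (i)): for a unitary `M`-periodic gauge `t` and a base `W` there is a continuous linear map `J` of the
# chart model space `skewSub M` with `t·(chart_W Φ) = chart_{t·W} (J Φ)` and `‖J Φ‖ ≤ ‖Φ‖` for all `Φ` (`J Φ (r, κ) = Ad_{t(boxVec r + e_κ)} Φ(r, κ)`; ✓ p825865 gave `J Φ` pointwise)

Cell `pub-balaban`, rung (B)+1 sub-cell t4, lineage `b2b-balaban-t4-ne7-p1` (CRUX PROVER NE7 #1 = OWNER of BINDER row NE7), generation 114.  Memo `t4/b2b-balaban-t4-ne7-p1-g114/ROAD-G114.md` §11.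
WHAT ([folklore]; 0 def, 0 sorry).  **`gaugeAct_chart_transferL`**.
HONEST FRAMING (page 1): an elementary letter; nothing of Bałaban's; NOT NE7, NOT NE3; spine 0∕9; finite T⁴ rung (B)+1 — NOT infinite volume, NOT mass gap, NOT BetaPertH, NOT Clay.
-/

set_option autoImplicit false

open scoped BigOperators Matrix Matrix.Norms.L2Operator
open NormedSpace Finset Set

namespace Summit.QuantumFields.BalabanUV.T4Continuum.NE7GaugeActChartTransferL

open Literature.MathematicalPhysics.QuantumFieldTheory.Balaban1983to89
open B7Prop1Explicit B7Prop2Explicit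
open AveragingDeficitTorusChart (TDir chart chartDir redN eq_wrap_add periodic_smul_vec)
open AveragingDeficitTwoLevelPrep (skewSub mem_skewSub)
open NE3EnergyShapes (IsUnitarySite IsPeriodicSite)
open NE7DatumCoordinateStabiliser (inv_mem_unitary)

noncomputable section

variable {n : Type} [Fintype n] [DecidableEq n]

/-- **LINEAR CHART TRANSFER**: `∃ J : skewSub M →L[ℝ] skewSub M` with `t·(chart_W Φ) = chart_{t·W} (J Φ)` and `‖J Φ‖ ≤ ‖Φ‖` for every `Φ`. [folklore] -/
theorem gaugeAct_chart_transferL [Nonempty n] {M : ℕ} [NeZero M] {t : Site 4 → (Matrix n n ℂ)ˣ} (htu : IsUnitarySite t) (htP : IsPeriodicSite t (M : ℤ))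
    (W : Site 4 → Fin 4 → (Matrix n n ℂ)ˣ) :
    ∃ J : ↥(skewSub 4 n M) →L[ℝ] ↥(skewSub 4 n M), ∀ Φ : ↥(skewSub 4 n M),
      gaugeAct t (chart (ContinuousLinearMap.id ℝ (Matrix n n ℂ)) M W (Φ : TDir 4 n M))
        = chart (ContinuousLinearMap.id ℝ (Matrix n n ℂ)) M (gaugeAct t W) ((J Φ : ↥(skewSub 4 n M)) : TDir 4 n M) ∧ ‖J Φ‖ ≤ ‖Φ‖ := by
  letI : CStarAlgebra (Matrix n n ℂ) := {}
  letI : NormedAlgebra ℚ (Matrix n n ℂ) := NormedAlgebra.restrictScalars ℚ ℂ (Matrix n n ℂ)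
  have hst : ∀ c : (Matrix n n ℂ)ˣ, c ∈ unitaryUnits (Matrix n n ℂ) → ((c⁻¹ : (Matrix n n ℂ)ˣ) : Matrix n n ℂ) = star (c : Matrix n n ℂ) := fun c hc =>
    Units.inv_eq_of_mul_eq_one_left (Unitary.star_mul_self_of_mem (mem_unitaryUnits.mp hc))
  -- the raw linear map on the model space
  set L₀ : TDir 4 n M →ₗ[ℝ] TDir 4 n M :=
    { toFun := fun Φ r κ => (t (boxVec M r + e κ) : Matrix n n ℂ) * Φ r κ * (((t (boxVec M r + e κ))⁻¹ : (Matrix n n ℂ)ˣ) : Matrix n n ℂ)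
      map_add' := fun Φ Ψ => by funext r κ; simp only [Pi.add_apply, mul_add, add_mul]
      map_smul' := fun a Φ => by funext r κ; simp only [Pi.smul_apply, RingHom.id_apply, mul_smul_comm, smul_mul_assoc] } with hL₀
  have hL₀app : ∀ (Φ : TDir 4 n M) r κ, L₀ Φ r κ = (t (boxVec M r + e κ) : Matrix n n ℂ) * Φ r κ * (((t (boxVec M r + e κ))⁻¹ : (Matrix n n ℂ)ˣ) : Matrix n n ℂ) :=
    fun Φ r κ => rfl
  have hmem : ∀ Φ : TDir 4 n M, Φ ∈ skewSub 4 n M → L₀ Φ ∈ skewSub 4 n M := fun Φ hΦ =>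
    mem_skewSub.mpr fun r κ => by
      rw [hL₀app, hst _ (htu _)]
      exact skewAdjoint.conjugate ((mem_skewSub.mp hΦ) r κ) _
  set J : ↥(skewSub 4 n M) →L[ℝ] ↥(skewSub 4 n M) := LinearMap.toContinuousLinearMap (L₀.restrict hmem) with hJ
  have hJapp : ∀ Φ : ↥(skewSub 4 n M), ((J Φ : ↥(skewSub 4 n M)) : TDir 4 n M) = L₀ (Φ : TDir 4 n M) := fun Φ => rfl
  have hP : ∀ (x : Site 4) (κ : Fin 4), t (x + e κ) = t (boxVec M (redN M x) + e κ) := fun x κ => by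
    conv_lhs => rw [eq_wrap_add M x, add_right_comm]
    exact periodic_smul_vec htP _ _
  refine ⟨J, fun Φ => ⟨?_, ?_⟩⟩
  · funext x κ
    apply Units.ext
    simp only [gaugeAct, chart, chartDir, Units.val_mul, val_expUnit, ContinuousLinearMap.id_apply]
    rw [hJapp, hL₀app, ← hP, NormedSpace.exp_units_conj]
    rw [show ∀ A B C D E : Matrix n n ℂ, A * B * C * (D * E * C) = A * (B * (C * D) * E) * C from fun A B C D E => by noncomm_ring, Units.inv_mul, mul_one]
  · rw [Submodule.coe_norm, Submodule.coe_norm (x := Φ), hJapp]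
    refine (pi_norm_le_iff_of_nonneg (norm_nonneg _)).mpr fun r => (pi_norm_le_iff_of_nonneg (norm_nonneg _)).mpr fun κ => ?_
    rw [hL₀app, CStarRing.norm_mul_mem_unitary _ (inv_mem_unitary (htu _)), CStarRing.norm_mem_unitary_mul _ (mem_unitaryUnits.mp (htu _))]
    exact (norm_le_pi_norm ((Φ : TDir 4 n M) r) κ).trans (norm_le_pi_norm _ _)

end

end Summit.QuantumFields.BalabanUV.T4Continuum.NE7GaugeActChartTransferL
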